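import Mathlib
import Literature.Analysis.FluidPDE.PressureDeterminedUpToTime
import Literature.Analysis.FluidPDE.SelfSimilarCollapseAnsatz
import Summits.NavierStokesRegularity.NavierStokesRegularity.Theorems.EulerZoomLiouvillePowerGaugeEulerLiouvilleSpiralPressureSlavingTools
import Summits.NavierStokesRegularity.NavierStokesRegularity.Theorems.EulerZoomLiouvillePowerGaugeEulerLiouvilleSelfSimilarPressureSlavingTools
import Summits.NavierStokesRegularity.NavierStokesRegularity.Theorems.EulerZoomLiouvillePowerGaugeEulerLiouvilleSelfSimilarPressureSlavingPastKill
import HarnessLib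

/-!
# Crux `EulerZoomLiouville.PowerGaugeEulerLiouville` (stmt-NavierStokesRegularity-19832), line `relative_equilibria` (ns-idea-11), R3a PORT RECIPE
# brick P4 (slaving half), file 2: SPIRAL PRESSURE SLAVING ON THE WINDOW SLAB (centred coordinates)

Route №10 `EulerZoomLiouville` (NavierStokesRegularity), crux E; width seat ns-sfl-p1 g11 under the LEAD ns-typeII-p2 (R3a recipe of
`Cruxes/PowerGaugeEulerLiouville/Lines/relative-equilibria.md`, brick P4 = spiral twin of `PressureSlaving.inClass_pastSelfSimilarPressure`
(…SelfSimilarPressureSlavingPast); file 1 = `…SpiralPressureSlavingTools`, the (D₁) growth half = `…SpiralPastPressureGrowth`).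

SPIRAL velocity about `(T, x₀)`, skew generator `S` (`⟪Sx, y⟫ = −⟪x, Sy⟫`), rate `γ`, profile `V`, on the past window `τ < T₁` (`T₁ ≤ 0`, `T₁ ≤ T`):
`u(τ, x) = λ^{γ−1} e^{(log λ)S} V(e^{−(log λ)S} λ^{−γ}(x − x₀))`, `λ = T − τ` (the line's `IsPastSpiral ρ T T₁ x₀ S u V` at `γ = 1/(2+ρ)`, `twist`
written out as `NormedSpace.exp`).  As for the untwisted past-exact strata, the pressure clause of the spiral stratum is REDUNDANT:

* `Spiral.ae_eq_rescaledRotatedPressure_top` — centred coordinates, window slab `s < S₁ ≤ 0`: `q(s, y) = β^{2(1−γ)} q(β s, β^{γ} R_β y)` a.e. for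
  every `β ≥ 1`, `R_β = e^{(log β)S}` (two pressures of ONE velocity — `Spiral.isDistributional_rescaledRotatedPressure_top`, KEY ALGEBRA (ii) —
  differ by a function of time, killed by the `D`-growth on the rotation-invariant cylinders `Q_a(S₁, 0)`);
* `Spiral.exists_profilePressure_top` — hence `q(s, y) = (−s)^{2(γ−1)} Q(e^{−(log(−s))S} (−s)^{−γ} y)` a.e., for a measurable SCALAR `Q`: UNTWIST
  `q'(s, y) := q(s, e^{(log(−s))S} y)` along the measure-preserving fibrewise rotation (`Spiral.measurePreserving_fibreRot_slab`), observe that `q'` is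
  one-sided scale invariant in the plain sense (`e^{(log(βλ))S} = R_β e^{(log λ)S}`), read off `Q` with `PressureSlaving.exists_profile_of_scaleInvariant_oneSided`,
  and twist back slice by slice;
(file 3 `…SpiralPressureSlaving` un-centres and states the member form).

WHAT THIS IS NOT: not NS, not E, not a stub: one brick (P4) of the port R3a of a width sub-line (spiral = `O(3)`-twisted self-similar stratum of
`stub_nonSelfSimilarRest`); a de-conditioning lemma on the MODEL lattice of the OPEN crux class 19832; no summit statement is proved by this file.
[folklore; RusinSverak2011 §2 p. 4; CaffarelliKohnNirenberg1982 §2; ChaeTsai2013DSS p. 4 (Perelman's rotated ansatz)]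
-/

noncomputable section

-- flat `Theorems/<Route><Decl>…` files of one crux share the namespace of the crux (tree convention: `Summit.<S>.<S>.…`)
set_option linter.dupNamespace false

open MeasureTheory Set Filter Topology Metric Function TopologicalSpace
open scoped ENNReal NNReal RealInnerProductSpace

namespace Summit.NavierStokesRegularity.NavierStokesRegularity.Theorems.PowerGaugeEulerLiouville

open Literature.Analysis Literature.Analysis.FunctionSpaces Literature.Analysis.FluidPDE

namespace Spiral

variable {S : EuclideanSpace ℝ (Fin 3) →L[ℝ] EuclideanSpace ℝ (Fin 3)}

/-! ### Centred coordinates: `q = q̃_β` a.e. on the window slab, `β ≥ 1` -/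

/-- **`q(s, y) = β^{2(1−γ)} q(β s, β^{γ} R_β y)` A.E. ON THE WINDOW SLAB** `(−∞, S₁) × ℝ³`, `S₁ ≤ 0`, for `β ≥ 1` (`R_β = e^{(log β)S}`):
`(w, q)` a distributional Euler pair there with `w` SPIRAL about the origin (skew `S`, profile `V`, rate `γ`) and
`∫∫_{Q_a(S₁, 0)} |q|^{3/2} ≤ K a^m` for `a ≥ a₀` (`K < ∞`, `m < 3`).  Proof = the untwisted `PressureSlaving.ae_eq_rescaledPressure_top` with the
rotated covariance `Spiral.isDistributional_rescaledRotatedPressure_top`: `q` and `q̃_β` are two pressures of ONE velocity, so they differ by a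
function of time (`ae_exists_const_of_forall_integral_mul_divergence_eq_zero`), which the `D`-growth kills
(`ae_eq_zero_of_ae_const_of_cylinderGrowth_top`; the cylinders `Q_a(S₁, 0)` are rotation invariant). [folklore; RusinSverak2011 §2 p. 4] -/
theorem ae_eq_rescaledRotatedPressure_top {γ β S₁ : ℝ} (hβ1 : 1 ≤ β) (hS₁ : S₁ ≤ 0)
    (hS : ∀ x y : EuclideanSpace ℝ (Fin 3), ⟪S x, y⟫ = -⟪x, S y⟫)
    {w : ℝ → EuclideanSpace ℝ (Fin 3) → EuclideanSpace ℝ (Fin 3)} {q : ℝ → EuclideanSpace ℝ (Fin 3) → ℝ}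
    {V : EuclideanSpace ℝ (Fin 3) → EuclideanSpace ℝ (Fin 3)}
    (hdist : IsDistributionalNSSolutionOn (slab (EuclideanSpace ℝ (Fin 3)) (Iio S₁) isOpen_Iio) 0 0 w q)
    {K : ℝ≥0∞} (hK : K ≠ ⊤) {m a₀ : ℝ} (hm : m < 3)
    (hD : ∀ a : ℝ, a₀ ≤ a →
      ∫⁻ z in parabolicCylinder a (S₁, (0 : EuclideanSpace ℝ (Fin 3))), ‖q z.1 z.2‖ₑ ^ (3 / 2 : ℝ) ≤ K * ENNReal.ofReal (a ^ m))
    (hw : ∀ s : ℝ, s < S₁ → w s = fun y => (-s) ^ (γ - 1) •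
      NormedSpace.exp ((Real.log (-s)) • S) (V (NormedSpace.exp ((-Real.log (-s)) • S) ((-s) ^ (-γ) • y)))) :
    ∀ᵐ z ∂(volume.restrict (Iio S₁ ×ˢ (univ : Set (EuclideanSpace ℝ (Fin 3))))),
      q z.1 z.2 = (β ^ (1 - γ)) ^ 2 * q (β * z.1) (β ^ γ • NormedSpace.exp ((Real.log β) • S) z.2) := by
  -- adapted from `PressureSlaving.ae_eq_rescaledPressure_top` (…SelfSimilarPressureSlavingPast)
  have hβ : 0 < β := one_pos.trans_le hβ1
  have hS0 : ∀ x : EuclideanSpace ℝ (Fin 3), ⟪S x, x⟫ = 0 := fun x => by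
    have h := hS x x
    rw [real_inner_comm (S x) x] at h
    linarith
  set γ' : ℝ := β ^ γ with hγ'def
  have hγ' : 0 < γ' := Real.rpow_pos_of_pos hβ _
  -- the fixed rotation `R_β = e^{(log β)S}` as a linear isometry
  obtain ⟨R, hR', hRs'⟩ := rss_exists_rot hS0 (-Real.log β)
  have hR : ∀ y, R y = NormedSpace.exp ((Real.log β) • S) y := fun y => by rw [hR', neg_neg]
  set qβ : ℝ → EuclideanSpace ℝ (Fin 3) → ℝ := (β ^ (1 - γ)) ^ 2 • stPull β γ' 0 (0 : EuclideanSpace ℝ (Fin 3)) q with hqβ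
  set qb : ℝ → EuclideanSpace ℝ (Fin 3) → ℝ := fun s y => qβ s (NormedSpace.exp ((Real.log β) • S) y) with hqb
  have hqb' : IsDistributionalNSSolutionOn (slab (EuclideanSpace ℝ (Fin 3)) (Iio S₁) isOpen_Iio) 0 0 w qb :=
    isDistributional_rescaledRotatedPressure_top hβ1 hS₁ hS hdist hw
  set F : ℝ → EuclideanSpace ℝ (Fin 3) → ℝ := fun t x => q t x - qb t x with hFdef
  suffices hF0 : ∀ᵐ z ∂(volume.restrict (Iio S₁ ×ˢ (univ : Set (EuclideanSpace ℝ (Fin 3))))), F z.1 z.2 = 0 by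
    filter_upwards [hF0] with z hz
    have e : q z.1 z.2 = qb z.1 z.2 := sub_eq_zero.1 hz
    rw [e, hqb, hqβ]
    simp only [smul_stPull_apply, zero_add, smul_eq_mul]
  have hql : LocallyIntegrableOn (uncurry q) (Iio S₁ ×ˢ (univ : Set (EuclideanSpace ℝ (Fin 3)))) volume := by
    have h := hdist.2.2.1; rwa [coe_slab] at h
  have hqbl : LocallyIntegrableOn (uncurry qb) (Iio S₁ ×ˢ (univ : Set (EuclideanSpace ℝ (Fin 3)))) volume := by
    have h := hqb'.2.2.1; rwa [coe_slab] at h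
  have hFl : LocallyIntegrableOn (uncurry F) (Iio S₁ ×ˢ (univ : Set (EuclideanSpace ℝ (Fin 3)))) volume := hql.sub hqbl
  -- `F` is a function of time a.e. (two pressures of one velocity, on the slabs `(T', S₁) × ℝ³`)
  have hconstT : ∀ T' : ℝ, ∀ᵐ t ∂(volume.restrict (Ioo T' S₁)), ∃ κ : ℝ,
      ∀ᵐ x ∂(volume : Measure (EuclideanSpace ℝ (Fin 3))), F t x = κ := by
    intro T'
    have hle : slab (EuclideanSpace ℝ (Fin 3)) (Ioo T' S₁) isOpen_Ioo ≤
        slab (EuclideanSpace ℝ (Fin 3)) (Iio S₁) isOpen_Iio := slab_mono Ioo_subset_Iio_self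
    refine ae_exists_const_of_forall_integral_mul_divergence_eq_zero (hFl.mono_set (prod_mono Ioo_subset_Iio_self le_rfl)) ?_
    intro ψ hψ
    have h := PressureSlaving.setIntegral_sub_mul_divergence_eq_zero (hdist.of_le hle) (hqb'.of_le hle) hψ
    rwa [coe_slab] at h
  have hconst : ∀ᵐ t ∂(volume.restrict (Iio S₁)), ∃ κ : ℝ,
      ∀ᵐ x ∂(volume : Measure (EuclideanSpace ℝ (Fin 3))), F t x = κ := by
    have hcover : Iio S₁ ⊆ ⋃ n : ℕ, Ioo (S₁ - ((n : ℝ) + 1)) S₁ := by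
      intro t ht
      obtain ⟨n, hn⟩ := exists_nat_gt (S₁ - t)
      exact mem_iUnion.2 ⟨n, ⟨by linarith, ht⟩⟩
    exact ae_restrict_of_ae_restrict_of_subset hcover ((ae_restrict_iUnion_iff _ _).2 fun n => hconstT _)
  -- the growth of `F` on the (rotation-invariant) cylinders hanging from the window top
  set L : ℝ := β + γ' + |S₁| + 1 with hL
  have hL1 : 1 ≤ L := by rw [hL]; linarith [hγ'.le, abs_nonneg S₁]
  set Kβ : ℝ≥0∞ := ‖(β ^ (1 - γ)) ^ 2‖ₑ ^ (3 / 2 : ℝ) *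
    ENNReal.ofReal (β * γ' ^ Module.finrank ℝ (EuclideanSpace ℝ (Fin 3)))⁻¹ with hKβ
  have hKβtop : Kβ ≠ ⊤ :=
    ENNReal.mul_ne_top (ENNReal.rpow_ne_top_of_nonneg (by norm_num) enorm_ne_top) ENNReal.ofReal_ne_top
  have hgrowth : ∀ a : ℝ, max a₀ 1 ≤ a →
      ∫⁻ z in parabolicCylinder a (S₁, (0 : EuclideanSpace ℝ (Fin 3))), ‖F z.1 z.2‖ₑ ^ (3 / 2 : ℝ) ≤
        (2 ^ ((3 / 2 : ℝ) - 1) * (K + Kβ * K * ENNReal.ofReal (L ^ m))) * ENNReal.ofReal (a ^ m) := by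
    intro a ha
    have ha₀ : a₀ ≤ a := (le_max_left _ _).trans ha
    have ha1 : 1 ≤ a := (le_max_right _ _).trans ha
    have ha0 : 0 < a := one_pos.trans_le ha1
    have hqa : ∫⁻ z in parabolicCylinder a (S₁, (0 : EuclideanSpace ℝ (Fin 3))), ‖qb z.1 z.2‖ₑ ^ (3 / 2 : ℝ) ≤
        Kβ * K * ENNReal.ofReal (L ^ m) * ENNReal.ofReal (a ^ m) := by
      have hsub := PressureSlaving.parabolicCylinder_subset_preimage_top hβ1 hγ' hS₁ ha1
      have hrot : ∫⁻ z in parabolicCylinder a (S₁, (0 : EuclideanSpace ℝ (Fin 3))), ‖qb z.1 z.2‖ₑ ^ (3 / 2 : ℝ) =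
          ∫⁻ z in parabolicCylinder a (S₁, (0 : EuclideanSpace ℝ (Fin 3))), ‖qβ z.1 z.2‖ₑ ^ (3 / 2 : ℝ) := by
        have h := setLIntegral_parabolicCylinder_comp_rot R
          (fun z : ℝ × EuclideanSpace ℝ (Fin 3) => ‖qβ z.1 z.2‖ₑ ^ (3 / 2 : ℝ)) a S₁
        refine Eq.trans (lintegral_congr fun z => ?_) h
        simp only [hqb, hR]
      calc ∫⁻ z in parabolicCylinder a (S₁, (0 : EuclideanSpace ℝ (Fin 3))), ‖qb z.1 z.2‖ₑ ^ (3 / 2 : ℝ)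
          = ∫⁻ z in parabolicCylinder a (S₁, (0 : EuclideanSpace ℝ (Fin 3))), ‖qβ z.1 z.2‖ₑ ^ (3 / 2 : ℝ) := hrot
        _ ≤ ∫⁻ z in stAffine β γ' 0 (0 : EuclideanSpace ℝ (Fin 3)) ⁻¹'
              parabolicCylinder (L * a) (S₁, (0 : EuclideanSpace ℝ (Fin 3))), ‖qβ z.1 z.2‖ₑ ^ (3 / 2 : ℝ) :=
            lintegral_mono_set hsub
        _ = Kβ * ∫⁻ z in parabolicCylinder (L * a) (S₁, (0 : EuclideanSpace ℝ (Fin 3))), ‖q z.1 z.2‖ₑ ^ (3 / 2 : ℝ) := by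
            rw [hqβ, setLIntegral_enorm_rpow_stRescale hβ hγ' 0 (0 : EuclideanSpace ℝ (Fin 3)) _ q _ (by norm_num), hKβ]
        _ ≤ Kβ * (K * ENNReal.ofReal ((L * a) ^ m)) := by
            gcongr
            exact hD _ (ha₀.trans (by nlinarith))
        _ = Kβ * K * ENNReal.ofReal (L ^ m) * ENNReal.ofReal (a ^ m) := by
            rw [Real.mul_rpow (by linarith) ha0.le, ENNReal.ofReal_mul (Real.rpow_nonneg (by linarith) _)]
            ring
    have hpa := hD a ha₀
    have hsubQ : parabolicCylinder a (S₁, (0 : EuclideanSpace ℝ (Fin 3))) ⊆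
        Iio S₁ ×ˢ (univ : Set (EuclideanSpace ℝ (Fin 3))) := by
      rintro ⟨t, x⟩ hz
      rw [mem_parabolicCylinder] at hz
      exact mem_prod.2 ⟨hz.1.2, mem_univ _⟩
    have hqmQ : AEMeasurable (fun z : ℝ × EuclideanSpace ℝ (Fin 3) => ‖q z.1 z.2‖ₑ ^ (3 / 2 : ℝ))
        (volume.restrict (parabolicCylinder a (S₁, (0 : EuclideanSpace ℝ (Fin 3))))) :=
      ((hql.aestronglyMeasurable.mono_measure (Measure.restrict_mono hsubQ le_rfl)).aemeasurable.enorm.pow_const _)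
    calc ∫⁻ z in parabolicCylinder a (S₁, (0 : EuclideanSpace ℝ (Fin 3))), ‖F z.1 z.2‖ₑ ^ (3 / 2 : ℝ)
        ≤ ∫⁻ z in parabolicCylinder a (S₁, (0 : EuclideanSpace ℝ (Fin 3))),
            2 ^ ((3 / 2 : ℝ) - 1) * (‖q z.1 z.2‖ₑ ^ (3 / 2 : ℝ) + ‖qb z.1 z.2‖ₑ ^ (3 / 2 : ℝ)) := by
          refine lintegral_mono fun z => ?_
          calc ‖F z.1 z.2‖ₑ ^ (3 / 2 : ℝ) ≤ (‖q z.1 z.2‖ₑ + ‖qb z.1 z.2‖ₑ) ^ (3 / 2 : ℝ) := by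
                gcongr
                exact enorm_sub_le
            _ ≤ 2 ^ ((3 / 2 : ℝ) - 1) * (‖q z.1 z.2‖ₑ ^ (3 / 2 : ℝ) + ‖qb z.1 z.2‖ₑ ^ (3 / 2 : ℝ)) :=
                ENNReal.rpow_add_le_mul_rpow_add_rpow _ _ (by norm_num)
      _ = 2 ^ ((3 / 2 : ℝ) - 1) * ((∫⁻ z in parabolicCylinder a (S₁, (0 : EuclideanSpace ℝ (Fin 3))), ‖q z.1 z.2‖ₑ ^ (3 / 2 : ℝ)) +
            ∫⁻ z in parabolicCylinder a (S₁, (0 : EuclideanSpace ℝ (Fin 3))), ‖qb z.1 z.2‖ₑ ^ (3 / 2 : ℝ)) := by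
          rw [lintegral_const_mul' _ _ (ENNReal.rpow_ne_top_of_nonneg (by norm_num) ENNReal.ofNat_ne_top),
            lintegral_add_left' hqmQ]
      _ ≤ 2 ^ ((3 / 2 : ℝ) - 1) * (K * ENNReal.ofReal (a ^ m) + Kβ * K * ENNReal.ofReal (L ^ m) * ENNReal.ofReal (a ^ m)) := by
          gcongr
      _ = (2 ^ ((3 / 2 : ℝ) - 1) * (K + Kβ * K * ENNReal.ofReal (L ^ m))) * ENNReal.ofReal (a ^ m) := by ring
  have hKtot : 2 ^ ((3 / 2 : ℝ) - 1) * (K + Kβ * K * ENNReal.ofReal (L ^ m)) ≠ ⊤ := by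
    refine ENNReal.mul_ne_top (ENNReal.rpow_ne_top_of_nonneg (by norm_num) ENNReal.ofNat_ne_top) ?_
    exact ENNReal.add_ne_top.2 ⟨hK, ENNReal.mul_ne_top (ENNReal.mul_ne_top hKβtop hK) ENNReal.ofReal_ne_top⟩
  exact PressureSlaving.ae_eq_zero_of_ae_const_of_cylinderGrowth_top (r := 3 / 2) (by norm_num) hFl.aestronglyMeasurable
    hconst hKtot hm hgrowth

/-- **SPIRAL SLAVING ON THE WINDOW SLAB (centred coordinates).**  Under the hypotheses of `ae_eq_rescaledRotatedPressure_top` there is a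
measurable SCALAR profile `Q` with `q(s, y) = (−s)^{2(γ−1)} Q(e^{−(log(−s))S} (−s)^{−γ} y)` for a.e. `y`, for a.e. `s < S₁`.  Proof: UNTWIST —
`q'(s, y) := q(s, e^{(log(−s))S} y)` is a.e.-strongly measurable (the fibrewise rotation preserves the slab measure,
`Spiral.measurePreserving_fibreRot_slab`) and ONE-SIDED SCALE INVARIANT in the untwisted sense (`e^{(log(β λ))S} = R_β e^{(log λ)S}`), so
`PressureSlaving.exists_profile_of_scaleInvariant_oneSided` gives `Q`; twist back slice by slice (`Killing.measurePreserving_expSkew`). [folklore] -/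
theorem exists_profilePressure_top {γ S₁ : ℝ} (hS₁ : S₁ ≤ 0)
    (hS : ∀ x y : EuclideanSpace ℝ (Fin 3), ⟪S x, y⟫ = -⟪x, S y⟫)
    {w : ℝ → EuclideanSpace ℝ (Fin 3) → EuclideanSpace ℝ (Fin 3)} {q : ℝ → EuclideanSpace ℝ (Fin 3) → ℝ}
    {V : EuclideanSpace ℝ (Fin 3) → EuclideanSpace ℝ (Fin 3)}
    (hdist : IsDistributionalNSSolutionOn (slab (EuclideanSpace ℝ (Fin 3)) (Iio S₁) isOpen_Iio) 0 0 w q)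
    {K : ℝ≥0∞} (hK : K ≠ ⊤) {m a₀ : ℝ} (hm : m < 3)
    (hD : ∀ a : ℝ, a₀ ≤ a →
      ∫⁻ z in parabolicCylinder a (S₁, (0 : EuclideanSpace ℝ (Fin 3))), ‖q z.1 z.2‖ₑ ^ (3 / 2 : ℝ) ≤ K * ENNReal.ofReal (a ^ m))
    (hw : ∀ s : ℝ, s < S₁ → w s = fun y => (-s) ^ (γ - 1) •
      NormedSpace.exp ((Real.log (-s)) • S) (V (NormedSpace.exp ((-Real.log (-s)) • S) ((-s) ^ (-γ) • y)))) :
    ∃ Q : EuclideanSpace ℝ (Fin 3) → ℝ, Measurable Q ∧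
      ∀ᵐ s ∂(volume.restrict (Iio S₁)), ∀ᵐ y ∂(volume : Measure (EuclideanSpace ℝ (Fin 3))),
        q s y = (-s) ^ (2 * (γ - 1)) * Q (NormedSpace.exp ((-Real.log (-s)) • S) ((-s) ^ (-γ) • y)) := by
  have hS0 : ∀ x : EuclideanSpace ℝ (Fin 3), ⟪S x, x⟫ = 0 := fun x => by
    have h := hS x x
    rw [real_inner_comm (S x) x] at h
    linarith
  -- ### untwist along the fibrewise rotation `Φ(s, y) = (s, e^{(log(−s))S} y)`
  set Φ : ℝ × EuclideanSpace ℝ (Fin 3) → ℝ × EuclideanSpace ℝ (Fin 3) :=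
    fun z => (z.1, NormedSpace.exp ((Real.log (-z.1)) • S) z.2) with hΦ
  have hΦmp : MeasurePreserving Φ (volume.restrict (Iio S₁ ×ˢ (univ : Set (EuclideanSpace ℝ (Fin 3)))))
      (volume.restrict (Iio S₁ ×ˢ (univ : Set (EuclideanSpace ℝ (Fin 3))))) :=
    measurePreserving_fibreRot_slab hS0 (Real.measurable_log.comp measurable_neg) S₁
  set q' : ℝ → EuclideanSpace ℝ (Fin 3) → ℝ := fun s y => q s (NormedSpace.exp ((Real.log (-s)) • S) y) with hq'
  have hq'eq : uncurry q' = uncurry q ∘ Φ := by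
    funext z; rfl
  have hqm : AEStronglyMeasurable (uncurry q) (volume.restrict (Iio S₁ ×ˢ (univ : Set (EuclideanSpace ℝ (Fin 3))))) := by
    have h := hdist.2.2.1.aestronglyMeasurable; rwa [coe_slab] at h
  have hq'm : AEStronglyMeasurable (uncurry q') (volume.restrict (Iio S₁ ×ˢ (univ : Set (EuclideanSpace ℝ (Fin 3))))) := by
    rw [hq'eq]
    exact hqm.comp_measurePreserving hΦmp
  -- ### `q'` is one-sided scale invariant in the untwisted sense
  have hinv' : ∀ β : ℝ, 1 ≤ β → ∀ᵐ z ∂(volume.restrict (Iio S₁ ×ˢ (univ : Set (EuclideanSpace ℝ (Fin 3))))),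
      q' z.1 z.2 = (β ^ (1 - γ)) ^ 2 * q' (β * z.1) (β ^ γ • z.2) := by
    intro β hβ1
    have hβ : 0 < β := one_pos.trans_le hβ1
    have h1 := ae_eq_rescaledRotatedPressure_top hβ1 hS₁ hS hdist hK hm hD hw
    have h2 := hΦmp.quasiMeasurePreserving.ae h1
    filter_upwards [h2, ae_restrict_mem (measurableSet_Iio.prod MeasurableSet.univ)] with z hz hzmem
    have hz0 : z.1 < 0 := (mem_prod.1 hzmem).1.trans_le hS₁
    have hnz : 0 < -z.1 := neg_pos.2 hz0
    simp only [hΦ] at hz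
    simp only [hq']
    rw [hz, show -(β * z.1) = β * (-z.1) by ring, Real.log_mul hβ.ne' hnz.ne', rss_exp_add_smul, mul_apply_eq_comp]
    simp only [map_smul]
  -- ### the untwisted profile
  obtain ⟨Q, hQm, hQ⟩ := PressureSlaving.exists_profile_of_scaleInvariant_oneSided hS₁ hq'm hinv'
  refine ⟨Q, hQm, ?_⟩
  filter_upwards [hQ] with s hs
  -- ### twist back on the slice
  have h1 := ((Killing.measurePreserving_expSkew hS0 (-Real.log (-s))).quasiMeasurePreserving).ae hs
  filter_upwards [h1] with y hy
  simp only [hq'] at hy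
  have hback : NormedSpace.exp ((Real.log (-s)) • S) (NormedSpace.exp ((-Real.log (-s)) • S) y) = y := by
    have h := Killing.expSkew_neg_apply_expSkew S (-Real.log (-s)) y
    rwa [neg_neg] at h
  rw [hback] at hy
  rw [hy, selfSimilarCollapsePressure_apply, zero_sub, map_smul]

end Spiral

end Summit.NavierStokesRegularity.NavierStokesRegularity.Theorems.PowerGaugeEulerLiouville

end
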